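import Literature.NumberTheory.Transcendental.LinEDSCells
import HarnessLib

/-!
# `KernelModuloPeriodConjecture`, line `Sketch`: EDS cell block certificate, weight 18, block TF

Crux `FurushoPentagon.KernelModuloPeriodConjecture` (stmt-KontsevichZagierPeriods-15058), line
`Sketch`, algebraic leaf `AssociatorHoffmanSpanning` (Hoffman words span `𝒪(GroupLike ∩ Pent)`
weight by weight), weight `18`: `2^16 - d_18 = 65471` non-Hoffman admissible words. Block
`TF` (block 49 of 50, in chain order) of the weight-18 CELL block certificate
(`Literature/NumberTheory/Transcendental/LinEDSCells.lean`, `LinEDS.checkBlockC`): the block is the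
union of the cells `[(16, []), (17, [])]` (a cell `(D, [ℓ₁, ℓ₂, …])` = the columns of depth `D` with last
parts `ℓ₁, ℓ₂, …`), `17` columns, listed in increasing order of residue modulo `W' = 2049` (distinct
residues, `LinEDS.incMod`; fuel `63`: `2^17 ≤ 2049·64`), then `17` groups of encoded double-shuffle
row names `(s,t)` in pivot order (0 genuine groups, 17 member rows in all: a group's
row is the mod-2 shadow of the SUM of its members' integer rows), with no bit in the later cells
`[]` and full rank mod 2 when masked to the block and XOR-folded into width `W'` — decided by
`decide +kernel` in one kernel run. The masks of the cells are generated by the engine's DP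
(`LinEDS.cellMask`), so the file makes no pass over the `2^15` odd codes. Off-line generator and
exact replay of the kernel's check: lead c7 (`offline/blockrank.py`, `offline/mkcert.py`,
`offline/lineds.py`, the last validated against the accepted weight-10/16 certificates).

References: K. Ihara, M. Kaneko, D. Zagier, Compos. Math. 142 (2006) §2, Conjecture 1
[IharaKanekoZagier2006]; M. Kaneko, M. Noro, K. Tsurumaki, IMA Vol. 148 (2008) 47–58 (ranks of the
EDS matrix modulo a prime, to weight 20); F. Brown, Ann. of Math. 175 (2012) Thm 1.1 [Brown2012].
-/

namespace Summit.KontsevichZagierPeriods.FurushoPentagon.KernelModuloPeriodConjecture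

open Literature.NumberTheory.Transcendental

set_option maxRecDepth 32768 in
set_option maxHeartbeats 0 in
/-- **EDS cell block certificate, weight `18`, block `TF`** (`W' = 2049`, fuel `63`; cells, later
cells, the `17` block columns in residue order, the `17` groups of encoded row names in pivot
order): a closed computation checked by the kernel (`decide +kernel`; recursion limit raised and
heartbeat limit lifted only for the literals and the kernel run). [cite: IharaKanekoZagier2006, Conjecture 1] -/
theorem edsCheckBlockCEnc_18_TF : LinEDS.checkBlockCEnc2 18 2049 63
    [(16, []), (17, [])]
    [] [
    130047, 130559, 130815, 130943, 131007, 131039, 131055, 131063, 131067, 131069, 131071, 129023, 126975, 122879, 114687, 98303, 65535] [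
    [206157381635], [401606143], [401606399], [99620863], [49297407], [5357567], [200281087], [99621887], [206153187331], [206155284483], [51538558987], [25768755223], [24145919], [200281599], [49295359], [188977512451], [171797643267]] = true := by
  decide +kernel

/-- **Registered data stub `stub_edsBlockC_18_TF`**: some width with enough fuel, column list and
groups of names pass the weight-`18` cell block check for block `TF` — the data above.
[cite: IharaKanekoZagier2006, Conjecture 1] -/
theorem stub_edsBlockC_18_TF :
    ∃ (W' f : ℕ) (L : List ℕ) (groups : List (List (List ℕ × List ℕ))),
      2 ^ (18 - 1) ≤ W' * (f + 1) ∧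
        LinEDS.checkBlockC 18 W' f [(16, []), (17, [])]
          [] L groups = true :=
  ⟨2049, 63, _, _, by norm_num, edsCheckBlockCEnc_18_TF⟩

end Summit.KontsevichZagierPeriods.FurushoPentagon.KernelModuloPeriodConjecture
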